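import Mathlib.Algebra.CharP.Two
import Mathlib.Algebra.BigOperators.Group.Finset.Powerset
import Literature.Computability.MetaComplexity.ParityModTestCosetDensity
import HarnessLib

/-!
# Möbius coefficients on the cube in characteristic 2: the coefficients of a MOD-3 test and the
# paired-level law for functions vanishing on a parity coset

Over a field of characteristic `2` the multilinear (Möbius) coefficient of `u^T` of a function
`R : {0,1}^z → F` is `c(T) = Σ_{T' ⊆ T} R(𝟙_{T'})` (no signs), and Möbius inversion reads
`R(𝟙_T) = Σ_{T' ⊆ T} c(T')` — the pseudo-Boolean multilinear representation [BorosHammer2002, Prop. 2]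
reduced mod `2` (the tree's integer version is `PseudoBoolean.coeff`,
`Literature/Combinatorics/Optimization/PseudoBooleanMultilinear.lean`).  This file proves two
statements about these coefficients requested, typed verbatim, by the cell qa-qnc0 (planner file
`exp35/Sketch35.lean` §PairedLevel, ROUND-34 §12.7; targets `AffBells35.TestMobius` (P-38q) and
`AffBells35.PairedLevelLaw` (P-38p)); neither is located in print in this form, both are SUPPLIED HERE:

* `testMobius` — for the MOD-3 test `t(u) = 1 + [Σ_{u_i=1} w_i = r]` the coefficient of `u^T` is
  BOOLEAN: `1` iff `T ⊆ supp w` and `Σ_{i∈T} w_i + r ≠ 0 (mod 3)`, else `0`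
  (subset counting: `#{T' ⊆ T : Σ_{T'} w = r}` is odd iff `r ≢ −Σ_T w`, for `T ≠ ∅` inside `supp w`);
* `pairedLevelLaw` — `R` vanishes on the parity coset `H_ε = {u : #ones(u) ≡ ε}`
  (`ParityModTestDensity.parityCoset`) iff `[ε = false ⇒ c(∅) = 0]` and
  `c(T) = Σ_{i∈T} c(T ∖ i)` for every non-empty `T` with `|T| ≡ ε (mod 2)`.  The engine is the
  characteristic-2 identity `c(T) + Σ_{i∈T} c(T∖i) = Σ_{T' ⊆ T, |T'| ≡ |T|} R(𝟙_{T'})`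
  (`mobiusCoeff_add_sum_erase`; each `T' ⊆ T` is counted `1 + |T ∖ T'|` times).

No named facts.
-/

namespace Literature.Computability.MetaComplexity

open Finset

open Literature.Computability.MetaComplexity.ParityModTestDensity

namespace CosetMobius

variable {F : Type*} [Field F] {z : ℕ}

/-- Möbius (multilinear) coefficient of `u^T` of a function on the cube `{0,1}^z`:
`Σ_{T' ⊆ T} R(1_{T'})` (characteristic 2: no signs).  Typed `AffBells35.mobiusCoeff` verbatim.
[cite: BorosHammer2002, Prop. 2 (multilinear representation, Möbius coefficients)] -/
def mobiusCoeff (R : (Fin z → Bool) → F) (T : Finset (Fin z)) : F :=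
  ∑ T' ∈ T.powerset, R (fun i => decide (i ∈ T'))

/-! ### 1. Characteristic-2 bookkeeping -/

section CharTwoTools

variable [CharP F 2]

/-- [folklore] -/
private theorem two_eq_zero' : (2 : F) = 0 := by
  have h := CharP.cast_eq_zero F 2
  simpa using h

/-- [folklore] -/
private theorem natCast_eq_ite (n : ℕ) : (n : F) = if n % 2 = 1 then 1 else 0 := by
  rcases Nat.even_or_odd n with ⟨k, rfl⟩ | ⟨k, rfl⟩
  · rw [if_neg (by omega), show k + k = 2 * k by ring, Nat.cast_mul, Nat.cast_ofNat, two_eq_zero',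
      zero_mul]
  · rw [if_pos (by omega), Nat.cast_add, Nat.cast_mul, Nat.cast_ofNat, two_eq_zero', zero_mul,
      zero_add, Nat.cast_one]

/-- `[P] + [Q] = [R]` in characteristic `2` as soon as `R ↔ (P xor Q)`. [folklore] -/
private theorem ite_add_ite_of_iff {P Q R : Prop} [Decidable P] [Decidable Q] [Decidable R]
    (h : ¬ (P ↔ Q) ↔ R) :
    ((if P then (1 : F) else 0) + if Q then 1 else 0) = if R then 1 else 0 := by
  by_cases hP : P <;> by_cases hQ : Q
  · have hR : ¬ R := fun hR => (h.2 hR) (iff_of_true hP hQ)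
    rw [if_pos hP, if_pos hQ, if_neg hR, show (1 : F) + 1 = 2 by norm_num, two_eq_zero']
  · have hR : R := h.1 fun e => hQ (e.1 hP)
    rw [if_pos hP, if_neg hQ, if_pos hR, add_zero]
  · have hR : R := h.1 fun e => hP (e.2 hQ)
    rw [if_neg hP, if_pos hQ, if_pos hR, zero_add]
  · have hR : ¬ R := fun hR => (h.2 hR) (iff_of_false hP hQ)
    rw [if_neg hP, if_neg hQ, if_neg hR, add_zero]

/-- [folklore] -/
private theorem eq_of_add_eq_zero {a b : F} (h : a + b = 0) : a = b := by
  have := eq_neg_of_add_eq_zero_left h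
  rwa [CharTwo.neg_eq] at this

end CharTwoTools

/-! ### 2. The coefficients of a MOD-3 test (P-38q) -/

section Test

/-- `#{T' ⊆ T : Σ_{i∈T'} w_i = r}` as an element of `F`. [folklore] -/
private def subsetCount (w : Fin z → ZMod 3) (T : Finset (Fin z)) (r : ZMod 3) : F :=
  ∑ T' ∈ T.powerset, if (∑ i ∈ T', w i) = r then (1 : F) else 0

/-- [folklore] -/
private theorem subsetCount_empty (w : Fin z → ZMod 3) (r : ZMod 3) :
    (subsetCount w ∅ r : F) = if r = 0 then 1 else 0 := by
  unfold subsetCount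
  rw [powerset_empty, sum_singleton, sum_empty]
  by_cases h : r = 0 <;> simp [h, eq_comm]

/-- The insert recursion `c_{T ∪ j}(r) = c_T(r) + c_T(r − w_j)`. [folklore] -/
private theorem subsetCount_insert (w : Fin z → ZMod 3) {T : Finset (Fin z)} {j : Fin z} (hj : j ∉ T)
    (r : ZMod 3) :
    (subsetCount w (insert j T) r : F) = subsetCount w T r + subsetCount w T (r - w j) := by
  classical
  unfold subsetCount
  rw [sum_powerset_insert hj]
  congr 1
  refine sum_congr rfl fun U hU => ?_
  have hjU : j ∉ U := fun h => hj (mem_powerset.1 hU h)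
  rw [sum_insert hjU]
  have hiff : w j + ∑ x ∈ U, w x = r ↔ ∑ x ∈ U, w x = r - w j :=
    ⟨fun h => by rw [← h]; ring, fun h => by rw [h]; ring⟩
  by_cases h : ∑ x ∈ U, w x = r - w j
  · rw [if_pos h, if_pos (hiff.2 h)]
  · rw [if_neg h, if_neg fun h' => h (hiff.1 h')]

variable [CharP F 2]

/-- If some `w_i = 0` on `T`, the count is even. [folklore] -/
private theorem subsetCount_eq_zero_of_zero (w : Fin z → ZMod 3) {T : Finset (Fin z)} {i : Fin z}
    (hi : i ∈ T) (hwi : w i = 0) (r : ZMod 3) : (subsetCount w T r : F) = 0 := by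
  classical
  -- peel off i: T = insert i (T.erase i)
  have hT : T = insert i (T.erase i) := (insert_erase hi).symm
  rw [hT, subsetCount_insert w (notMem_erase i T), hwi, sub_zero, ← two_mul, two_eq_zero', zero_mul]

/-- Closed form on the support: for non-empty `T` with all `w_i ≠ 0`,
`#{T' ⊆ T : Σ_{T'} w = r} ≡ [Σ_T w + r ≠ 0] (mod 2)`. [folklore] -/
private theorem subsetCount_eq_of_ne_zero (w : Fin z → ZMod 3) :
    ∀ T : Finset (Fin z), T.Nonempty → (∀ i ∈ T, w i ≠ 0) → ∀ r : ZMod 3,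
      (subsetCount w T r : F) = if (∑ i ∈ T, w i) + r ≠ 0 then 1 else 0 := by
  classical
  intro T
  induction T using Finset.induction_on with
  | empty => intro h; exact absurd h (by simp)
  | @insert j T hj ih =>
    intro _ hw r
    have hwj : w j ≠ 0 := hw j (mem_insert_self j T)
    rw [subsetCount_insert w hj, sum_insert hj]
    by_cases hT : T.Nonempty
    · have hw' : ∀ i ∈ T, w i ≠ 0 := fun i hi => hw i (mem_insert_of_mem hi)
      rw [ih hT hw' r, ih hT hw' (r - w j)]
      have key : ∀ s r x : ZMod 3, x ≠ 0 →
          (¬ ((s + r ≠ 0) ↔ (s + (r - x) ≠ 0)) ↔ x + s + r ≠ 0) := by decide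
      exact ite_add_ite_of_iff (key _ r (w j) hwj)
    · rw [not_nonempty_iff_eq_empty.1 hT, subsetCount_empty, subsetCount_empty, sum_empty]
      have key : ∀ r x : ZMod 3, x ≠ 0 → (¬ ((r = 0) ↔ (r - x = 0)) ↔ x + 0 + r ≠ 0) := by decide
      exact ite_add_ite_of_iff (key r (w j) hwj)

/-- `(2^{|T|} : F) = [T = ∅]` in characteristic 2. [folklore] -/
private theorem two_pow_card_eq_ite (T : Finset (Fin z)) :
    ((2 ^ T.card : ℕ) : F) = if T = ∅ then 1 else 0 := by
  by_cases hT : T = ∅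
  · rw [if_pos hT, hT, card_empty, pow_zero, Nat.cast_one]
  · have hn : T.card ≠ 0 := fun h => hT (card_eq_zero.1 h)
    rw [if_neg hT, Nat.cast_pow, Nat.cast_ofNat, two_eq_zero', zero_pow hn]

/-- **Möbius coefficients of a MOD-3 test (`P-38q`; typed `AffBells35.TestMobius` verbatim).**  For
`t(u) = 1 + [Σ_{u_i=1} w_i = r]` the coefficient of `u^T` is Boolean: `1` iff `T ⊆ supp w` and
`Σ_{i∈T} w_i + r ≢ 0 (mod 3)`, else `0`.
[cite: BorosHammer2002, Prop. 2 (Möbius coefficients); closed form for MOD-3 tests supplied here (qa-qnc0 ROUND-34 §12.7)] -/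
theorem testMobius (F : Type*) [Field F] [CharP F 2] (z : ℕ) (w : Fin z → ZMod 3) (r : ZMod 3)
    (T : Finset (Fin z)) :
    mobiusCoeff (fun u : Fin z → Bool => (1 : F) + if (∑ i, if u i then w i else 0) = r then 1 else 0) T
      = if (∀ i ∈ T, w i ≠ 0) ∧ (∑ i ∈ T, w i) + r ≠ 0 then 1 else 0 := by
  classical
  -- the test at an indicator vector reads Σ_{i ∈ T'} w_i
  have hlin : ∀ T' : Finset (Fin z),
      (∑ i, if decide (i ∈ T') = true then w i else 0) = ∑ i ∈ T', w i := by
    intro T'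
    rw [← sum_filter]; congr 1; ext i; simp
  have hsplit : mobiusCoeff (fun u : Fin z → Bool =>
      (1 : F) + if (∑ i, if u i then w i else 0) = r then 1 else 0) T
      = ((2 ^ T.card : ℕ) : F) + subsetCount w T r := by
    unfold mobiusCoeff subsetCount
    rw [sum_add_distrib]
    congr 1
    · rw [sum_const, card_powerset, nsmul_eq_mul, mul_one]
    · exact sum_congr rfl fun T' _ => by simp only [hlin]
  rw [hsplit, two_pow_card_eq_ite]
  by_cases hzero : ∃ i ∈ T, w i = 0
  · obtain ⟨i, hi, hwi⟩ := hzero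
    have hT : T ≠ ∅ := ne_empty_of_mem hi
    rw [subsetCount_eq_zero_of_zero w hi hwi, if_neg hT, add_zero, if_neg]
    exact fun h => h.1 i hi hwi
  · push Not at hzero
    by_cases hT : T = ∅
    · subst hT
      rw [if_pos rfl, subsetCount_empty]
      by_cases hr : r = 0
      · rw [if_pos hr, if_neg (by simp [hr]), show (1 : F) + 1 = 2 by norm_num, two_eq_zero']
      · rw [if_neg hr, add_zero, if_pos ⟨fun i hi => absurd hi (by simp), by simpa using hr⟩]
    · rw [if_neg hT, zero_add, subsetCount_eq_of_ne_zero w T (nonempty_iff_ne_empty.2 hT) hzero r]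
      by_cases h : (∑ i ∈ T, w i) + r ≠ 0
      · rw [if_pos h, if_pos ⟨hzero, h⟩]
      · rw [if_neg h, if_neg fun h' => h h'.2]

end Test

/-! ### 3. The paired-level law (P-38p) -/

section Law

/-- The indicator vector of a set of coordinates. [folklore] -/
private def ind (T : Finset (Fin z)) : Fin z → Bool := fun i => decide (i ∈ T)

/-- [folklore] -/
private theorem ind_mem_parityCoset_iff (T : Finset (Fin z)) (ε : Bool) :
    ind T ∈ parityCoset z ε ↔ decide (Odd T.card) = ε := by
  classical
  have hT : (univ.filter fun i : Fin z => ind T i = true) = T := by ext i; simp [ind]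
  unfold parityCoset
  rw [mem_filter, hT]
  simp

/-- [folklore] -/
private theorem eq_ind (u : Fin z → Bool) : u = ind (univ.filter fun i => u i = true) := by
  funext i; simp [ind]

/-- Subsets of `T.erase i` are the subsets of `T` avoiding `i`. [folklore] -/
private theorem powerset_erase_eq (T : Finset (Fin z)) (i : Fin z) :
    (T.erase i).powerset = T.powerset.filter fun T' => i ∉ T' := by
  classical
  ext U
  simp only [mem_powerset, mem_filter]
  constructor
  · intro h
    exact ⟨h.trans (erase_subset i T), fun hi => notMem_erase i T (h hi)⟩
  · rintro ⟨h, hi⟩ x hx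
    exact mem_erase.2 ⟨fun e => hi (e ▸ hx), h hx⟩

variable [CharP F 2]

/-- THE ENGINE: in characteristic `2`, `c(T) + Σ_{i∈T} c(T∖i) = Σ_{T' ⊆ T, |T'| ≡ |T| (2)} R(1_{T'})`
(each `T' ⊆ T` is counted `1 + |T ∖ T'|` times).
[cite: BorosHammer2002, Prop. 2; characteristic-2 identity supplied here (qa-qnc0 ROUND-34 §12.7)] -/
theorem mobiusCoeff_add_sum_erase (R : (Fin z → Bool) → F) (T : Finset (Fin z)) :
    mobiusCoeff R T + ∑ i ∈ T, mobiusCoeff R (T.erase i)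
      = ∑ T' ∈ T.powerset.filter (fun T' => T'.card % 2 = T.card % 2),
          R (fun i => decide (i ∈ T')) := by
  classical
  -- Σ_i c(T∖i) = Σ_{T'} |T∖T'|·R(T')
  have hswap : ∑ i ∈ T, mobiusCoeff R (T.erase i)
      = ∑ T' ∈ T.powerset, ((T \ T').card : F) * R (fun i => decide (i ∈ T')) := by
    unfold mobiusCoeff
    simp_rw [powerset_erase_eq, sum_filter]
    rw [sum_comm]
    refine sum_congr rfl fun T' _ => ?_
    rw [← sum_filter, sum_const, nsmul_eq_mul]
    have hfs : (T.filter fun i => i ∉ T') = T \ T' := by ext i; simp [mem_sdiff]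
    rw [hfs]
  rw [hswap, mobiusCoeff, ← sum_add_distrib, sum_filter]
  refine sum_congr rfl fun T' hT' => ?_
  have hsub : T' ⊆ T := mem_powerset.1 hT'
  rw [← one_add_mul, natCast_eq_ite, card_sdiff_of_subset hsub]
  have hle : T'.card ≤ T.card := card_le_card hsub
  by_cases h : T'.card % 2 = T.card % 2
  · rw [if_pos h, if_neg (by omega), add_zero, one_mul]
  · rw [if_neg h, if_pos (by omega), ← two_eq_zero' (F := F)]
    norm_num
    rw [two_eq_zero', zero_mul]

/-- **Paired-level law (`P-38p`; typed `AffBells35.PairedLevelLaw` verbatim).**  A function `R` on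
`{0,1}^z` with values in a field of characteristic `2` vanishes on the parity coset `H_ε` iff its
Möbius coefficients satisfy `c(T) = Σ_{i∈T} c(T∖i)` for every non-empty `T` with `|T| odd ↔ ε`, and
`c(∅) = 0` when `ε = false`.  (⇒) is the engine identity read on `H_ε`; (⇐) is the engine plus strong
induction on `|T|`.
[cite: BorosHammer2002, Prop. 2 (Möbius inversion on the cube); parity-coset law supplied here (qa-qnc0 ROUND-34 §12.7)] -/
theorem pairedLevelLaw (F : Type*) [Field F] [CharP F 2] (z : ℕ) (ε : Bool)
    (R : (Fin z → Bool) → F) :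
    (∀ u ∈ parityCoset z ε, R u = 0) ↔
      ((ε = false → mobiusCoeff R ∅ = 0) ∧
        ∀ T : Finset (Fin z), T.Nonempty → decide (Odd T.card) = ε →
          mobiusCoeff R T = ∑ i ∈ T, mobiusCoeff R (T.erase i)) := by
  classical
  have hpar : ∀ T T' : Finset (Fin z), T'.card % 2 = T.card % 2 →
      decide (Odd T'.card) = decide (Odd T.card) := by
    intro T T' h
    rw [decide_eq_decide, Nat.odd_iff, Nat.odd_iff, h]
  constructor
  · intro hR
    refine ⟨fun hε => ?_, fun T _ hTε => ?_⟩
    · -- c(∅) = R(0) and 0 ∈ H_false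
      unfold mobiusCoeff
      rw [powerset_empty, sum_singleton]
      refine hR _ ((ind_mem_parityCoset_iff ∅ ε).2 ?_)
      rw [hε, card_empty]; decide
    · apply eq_of_add_eq_zero
      rw [mobiusCoeff_add_sum_erase]
      refine sum_eq_zero fun T' hT' => hR _ ((ind_mem_parityCoset_iff T' ε).2 ?_)
      rw [hpar T T' (mem_filter.1 hT').2, hTε]
  · rintro ⟨h0, hlaw⟩
    -- every u is an indicator; strong induction on the cardinality of its support
    suffices key : ∀ n (T : Finset (Fin z)), T.card = n → decide (Odd T.card) = ε →
        R (fun i => decide (i ∈ T)) = 0 by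
      intro u hu
      rw [eq_ind u] at hu ⊢
      exact key _ _ rfl ((ind_mem_parityCoset_iff _ ε).1 hu)
    intro n
    induction n using Nat.strong_induction_on with
    | _ n ih =>
      intro T hTn hTε
      by_cases hT : T = ∅
      · subst hT
        have hε : ε = false := by rw [← hTε, card_empty]; decide
        have := h0 hε
        unfold mobiusCoeff at this
        rwa [powerset_empty, sum_singleton] at this
      · have hlawT := hlaw T (nonempty_iff_ne_empty.2 hT) hTε
        have heng := mobiusCoeff_add_sum_erase R T
        rw [hlawT, ← two_mul, two_eq_zero', zero_mul] at heng
        -- the right-hand side is R(1_T) plus lower terms, which vanish by induction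
        rw [sum_eq_single_of_mem (s := T.powerset.filter fun T' => T'.card % 2 = T.card % 2)
          T (mem_filter.2 ⟨mem_powerset.2 Subset.rfl, rfl⟩)] at heng
        · exact heng.symm
        · intro T' hT' hne
          have hsub : T' ⊆ T := mem_powerset.1 (mem_filter.1 hT').1
          have hlt : T'.card < T.card :=
            card_lt_card (lt_of_le_of_ne hsub fun h => hne (h ▸ rfl))
          exact ih T'.card (hTn ▸ hlt) T' rfl (by rw [hpar T T' (mem_filter.1 hT').2, hTε])

end Law

end CosetMobius

end Literature.Computability.MetaComplexity
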